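import Literature.MathematicalPhysics.QuantumFieldTheory.Balaban1983to89.B9Thm311PosDefAveragingSwap
import Literature.MathematicalPhysics.QuantumFieldTheory.Balaban1983to89.B9SectBQSizesY

/-!
# `Balaban1983to89.B9Eq315QYSizeWeightedL2Y` — T. Bałaban, *Propagators for lattice gauge theories in a background field*, Commun. Math. Phys. **99**
# (1985) 389–434 [Balaban1985BackgroundPropagators], (3.15) p. 393 («the sizes of `Q(U)`, `Q*(U)`») IN THE SCALE-WEIGHTED ℓ² NORMS:
# `‖Q(U)A‖²_w ≤ 2b₁ · Σ_b c_f²(L^{lev b})⁻²‖A(b)‖²_{HS}` for def-Y's straight-contour averaging `QY` at contractive (e.g. unitary) contour transporters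

statement-level skeleton of published theorems with citation tags; proofs where landed; nothing here is a claim about the Yang–Mills mass gap

THE PRINT.  (3.12)–(3.14) pp. 392–393: `Q(U)` averages parallel transports of a bond function along straight contours with nonnegative weights of total
mass one ([3] = Bałaban, *Propagators … I*, CMP **95** (1984), (1.18) p. 20); (3.15) p. 393: the sizes of `Q(U)`, `Q*(U)`; (3.26) p. 395: the weights
`a = a_j(Lʲη)⁻²` of the term `Q*(U)aQ(U)`; [4] = Bałaban, *Propagators … II*, CMP **96** (1984), (2.16)∕(2.20) pp. 225–226: the weight band, (2.2)–(2.4)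
p. 224: the end blocks of an index bond of level `J` have level `J − 1` or `J`.

WHY THIS FILE (cell `pub-ymgap`, node N06, seat `dag-n06-j` = bundle F5 rows 15–17, gen 35; director-ym ruling №375 «R2-A»).  This lineage's
`B9Thm311PosDefAveragingSwap` (✓) transfers row 17 (`Δ_a > 0`) from the straight-contour averaging to any re-pinned averaging pair modulo three ℓ² binders;
one of them — the ℓ²-SIZE `K′` of def-Y's own `QY parBY U` from the scale weight `c_f²(L^{lev b})⁻²` on fine bonds into the averaging weight `w` on index bonds —
is a fact about the letters of record, discharged HERE with `K′² = 2b₁` (the upper constant of the weight band).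

THE ROAD.  (i) `(Q(U)A)(ι) = Σ_f q_ι(f)·R(T_{ι,f})A(f)` with `q_ι ≥ 0`, `Σ_f q_ι(f) = 1` (`sum_abs_qK_eq_one`) and contractive transporters, so by convexity of the
Hilbert–Schmidt square `HS((QA)(ι)) ≤ Σ_f q_ι(f)·HS(A(f))` (§1–§2); (ii) hence `‖QA‖²_w ≤ Σ_f c(f)·HS(A(f))` with the COLUMN WEIGHT `c(f) = Σ_ι w(ι)q_ι(f)`;
(iii) `q_ι(f) ≠ 0` forces `lvl ι ∈ {lev f, lev f + 1}` (the contour of `ι` runs in its two end blocks, of levels `lvl ι − 1` or `lvl ι`, [4] (2.2)–(2.4));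
the band gives `w(ι) ≤ b₁·vol_{lvl ι}·c_f²L^{−2·lvl ι}` and the level-`J` column sums are `≤ vol_J⁻¹` (`sum_qwt_lvl_le`), so
`c(f) ≤ b₁c_f²(L^{−2lev f} + L^{−2(lev f+1)}) ≤ 2b₁c_f²(L^{lev f})⁻²` (§3); (iv) assemble (§4).

WHAT IS PROVED (sorry-free; 0 `def`).  §1 `norm_sum_mul_sq_le_of_mass_one`, `hs_sum_smul_R_le_of_mass_one` (convexity); §2 ★ `hs_QY_apply_le`;
§3 `lvl_eq_or_eq_succ_of_qK_ne_zero`, `w_le_band`, `sum_filter_w_mul_qK_le`, ★ `colWeight_qK_le`; §4 ★★ `trIP_w_QY_le` (any `G ≤ U(N)`-valued contour table),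
★★ `trIP_w_QY_parBY_le` (def-Y's `parBY` at a `G`-valued `U`), and the member-level reading `trIP_w_QY_parBY_le_member` (`b₁ = θ.b₁ ≥ 0` by `θ.hb`) = the
`hQYSize` binder of `B9Thm311PosDefAveragingSwap.posDefTr_deltaAQY_of_formGap` with `K′ = √(2θ.b₁)`.
HONEST SCOPE.  A size estimate for the letters of record from landed kernel facts; no statement about the knit letter; NOT a node discharge; count-neutral;
nothing continuum ∕ OS ∕ mass gap ∕ Clay.  No `sorry`, no `axiom`, no `instance`, no `notation`, no `def`.
-/

noncomputable section

namespace Literature.MathematicalPhysics.QuantumFieldTheory.Balaban1983to89.B9Eq315QYSizeWeightedL2Y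

open Literature.MathematicalPhysics.QuantumFieldTheory.Balaban1983to89
open B9Thm311ReadingCoords Node00
open B6KLevelCensusIndexV1 B6Ineq2142KLevelV1 B6GlobalChartV1 B9PinMembersKLevelV1 B9PinGeometryKLevelV1 B9GeoNormsKLevelV1
  B9BackgroundsKLevelV1 B9BackgroundsKLevelV1P
open Literature.MathematicalPhysics.QuantumFieldTheory.Balaban1983to89.B9Ineq369CurvatureSmallAtLettersY (hs_nonneg hs_R_le)
open Literature.MathematicalPhysics.QuantumFieldTheory.Balaban1983to89.B9Eq3104CommutatorSizesAvg (sum_abs_qK_eq_one)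
open Literature.MathematicalPhysics.QuantumFieldTheory.Balaban1983to89.B13BondAveragingReadingNumerals (qK_eq_qwt)
open Literature.MathematicalPhysics.QuantumFieldTheory.Balaban1983to89.B9Eq3132Ineq2142Covariant (ends_of_qwt_ne_zero two_le_RMh)
open Literature.MathematicalPhysics.QuantumFieldTheory.Balaban1983to89.B9GeoLemma21KLevelV1 (one_le_k)
open Literature.MathematicalPhysics.QuantumFieldTheory.Balaban1983to89.B6IndexBondLayersKLevelV1 (sum_qwt_lvl_le)
open Literature.MathematicalPhysics.QuantumFieldTheory.Balaban1983to89.B9SectBGWordDeltaAY (volY volY_pos)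
open Literature.MathematicalPhysics.QuantumFieldTheory.Balaban1983to89.B9Thm311FlippedBondForms (trIP_self_eq_sum qK_nonneg)

/-! ## §1 Convexity of the Hilbert–Schmidt square over a mass-one nonnegative kernel with contractive transports -/

section Convex

open scoped Matrix.Norms.L2Operator

variable {X : Type} [Fintype X] {N : ℕ}

/-- weighted Cauchy–Schwarz: `‖Σ_x w_x z_x‖² ≤ Σ_x w_x‖z_x‖²` for nonnegative weights of total mass one. [cite: Balaban1984PropagatorsI, (1.18) p.20 (weights of mass one), bookkeeping] -/
theorem norm_sum_mul_sq_le_of_mass_one (w : X → ℝ) (hw : ∀ x, 0 ≤ w x) (hsum : ∑ x, w x = 1) (z : X → ℂ) :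
    ‖∑ x, ((w x : ℝ) : ℂ) * z x‖ ^ 2 ≤ ∑ x, w x * ‖z x‖ ^ 2 := by
  have h1 : ‖∑ x, ((w x : ℝ) : ℂ) * z x‖ ≤ ∑ x, w x * ‖z x‖ := by
    refine (norm_sum_le _ _).trans (le_of_eq (Finset.sum_congr rfl fun x _ => ?_))
    rw [norm_mul, Complex.norm_real, Real.norm_eq_abs, abs_of_nonneg (hw x)]
  have h2 : (∑ x, w x * ‖z x‖) ^ 2 ≤ (∑ x, w x) * ∑ x, w x * ‖z x‖ ^ 2 := by
    have hcs := Finset.sum_mul_sq_le_sq_mul_sq Finset.univ (fun x => Real.sqrt (w x)) (fun x => Real.sqrt (w x) * ‖z x‖)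
    have e1 : ∀ x, Real.sqrt (w x) * (Real.sqrt (w x) * ‖z x‖) = w x * ‖z x‖ := fun x => by
      rw [← mul_assoc, Real.mul_self_sqrt (hw x)]
    have e2 : ∀ x, Real.sqrt (w x) ^ 2 = w x := fun x => Real.sq_sqrt (hw x)
    have e3 : ∀ x, (Real.sqrt (w x) * ‖z x‖) ^ 2 = w x * ‖z x‖ ^ 2 := fun x => by rw [mul_pow, Real.sq_sqrt (hw x)]
    simp only [e1, e2, e3] at hcs
    exact hcs
  have h0 : 0 ≤ ‖∑ x, ((w x : ℝ) : ℂ) * z x‖ := norm_nonneg _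
  calc ‖∑ x, ((w x : ℝ) : ℂ) * z x‖ ^ 2 ≤ (∑ x, w x * ‖z x‖) ^ 2 := pow_le_pow_left₀ h0 h1 2
    _ ≤ (∑ x, w x) * ∑ x, w x * ‖z x‖ ^ 2 := h2
    _ = ∑ x, w x * ‖z x‖ ^ 2 := by rw [hsum, one_mul]

/-- ★ **`HS(Σ_x w_x·R(T_x)Λ_x) ≤ Σ_x w_x·HS(Λ_x)`** for nonnegative weights of mass one and contractive transport pairs `|T_x|, |T_x⁻¹| ≤ 1` (unitary at the
record): convexity entry by entry, then `HS(R(T)Λ) ≤ HS(Λ)` (`hs_R_le`). [cite: Balaban1985BackgroundPropagators, (3.12) p.392, (3.15) p.393] -/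
theorem hs_sum_smul_R_le_of_mass_one (w : X → ℝ) (hw : ∀ x, 0 ≤ w x) (hsum : ∑ x, w x = 1)
    (T : X → (Matrix (Fin N) (Fin N) ℂ)ˣ)
    (hT : ∀ x, ‖(T x : Matrix (Fin N) (Fin N) ℂ)‖ ≤ 1 ∧ ‖(((T x)⁻¹ : (Matrix (Fin N) (Fin N) ℂ)ˣ) : Matrix (Fin N) (Fin N) ℂ)‖ ≤ 1)
    (Λ : X → Matrix (Fin N) (Fin N) ℂ) :
    ∑ a, ∑ c, ‖(∑ x, ((w x : ℝ) : ℂ) • B9Eq39Adjoint.R (T x) (Λ x)) a c‖ ^ 2 ≤ ∑ x, w x * ∑ a, ∑ c, ‖Λ x a c‖ ^ 2 := by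
  have hentry : ∀ a c, ‖(∑ x, ((w x : ℝ) : ℂ) • B9Eq39Adjoint.R (T x) (Λ x)) a c‖ ^ 2 ≤
      ∑ x, w x * ‖B9Eq39Adjoint.R (T x) (Λ x) a c‖ ^ 2 := by
    intro a c
    rw [Matrix.sum_apply]
    simp only [Matrix.smul_apply, smul_eq_mul]
    exact norm_sum_mul_sq_le_of_mass_one w hw hsum _
  calc ∑ a, ∑ c, ‖(∑ x, ((w x : ℝ) : ℂ) • B9Eq39Adjoint.R (T x) (Λ x)) a c‖ ^ 2
      ≤ ∑ a, ∑ c, ∑ x, w x * ‖B9Eq39Adjoint.R (T x) (Λ x) a c‖ ^ 2 :=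
        Finset.sum_le_sum fun a _ => Finset.sum_le_sum fun c _ => hentry a c
    _ = ∑ x, w x * ∑ a, ∑ c, ‖B9Eq39Adjoint.R (T x) (Λ x) a c‖ ^ 2 := by
        symm
        simp_rw [Finset.mul_sum]
        rw [Finset.sum_comm]
        refine Finset.sum_congr rfl fun a _ => ?_
        rw [Finset.sum_comm]
    _ ≤ ∑ x, w x * ∑ a, ∑ c, ‖Λ x a c‖ ^ 2 :=
        Finset.sum_le_sum fun x _ => mul_le_mul_of_nonneg_left (hs_R_le (hT x) (Λ x)) (hw x)

end Convex

/-! ## §2 The pointwise bound for `(Q(U)A)(ι)` -/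

section Pointwise

open scoped Matrix.Norms.L2Operator

variable {d ℓ : ℕ} {hd : 1 ≤ d + 1} {hL : Odd (ℓ + 1) ∧ 1 < ℓ + 1} {b₀ b₁ : ℝ} {N : ℕ}
variable (i : KIdx d ℓ hd hL b₀ b₁) {G : Subgroup (Matrix (Fin N) (Fin N) ℂ)ˣ}

/-- `Σ_f q_ι(f) = 1`. [cite: Balaban1984PropagatorsI, (1.18) p.20, (1.15) p.19] -/
theorem sum_qK_eq_one (ι : IBondY i) : ∑ f, qK i ι f = 1 := by
  rw [← sum_abs_qK_eq_one i ι]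
  exact Finset.sum_congr rfl fun f _ => (abs_of_nonneg (qK_nonneg i ι f)).symm

/-- ★ **`HS((Q(U)A)(ι)) ≤ Σ_f q_ι(f)·HS(A(f))`** for a `G`-valued contour table, `G ≤ U(N)` (contractive transports, `contractive_of_mem`).
[cite: Balaban1985BackgroundPropagators, (3.12) p.392, (3.15) p.393] -/
theorem hs_QY_apply_le (hG : G ≤ B7Prop2Explicit.unitaryUnits (Matrix (Fin N) (Fin N) ℂ)) (parB : BondParY (Matrix (Fin N) (Fin N) ℂ) i)
    (U : CfgY (Matrix (Fin N) (Fin N) ℂ) i) (hpar : ∀ s s', parB U s s' ∈ G) (A : FBondY i → Matrix (Fin N) (Fin N) ℂ) (ι : IBondY i) :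
    ∑ a, ∑ c, ‖QY i parB U A ι a c‖ ^ 2 ≤ ∑ f, qK i ι f * ∑ a, ∑ c, ‖A f a c‖ ^ 2 := by
  rw [QY, trLiftY_apply]
  exact hs_sum_smul_R_le_of_mass_one (qK i ι) (qK_nonneg i ι) (sum_qK_eq_one i ι) (qT i parB U ι)
    (fun f => B9Ineq349SiteFromConv342.contractive_of_mem hG (hpar _ _)) A

end Pointwise

/-! ## §3 The column weight `c(f) = Σ_ι w(ι)q_ι(f) ≤ 2b₁·c_f²(L^{lev f})⁻²` -/

section Column

variable {d ℓ : ℕ} {hd : 1 ≤ d + 1} {hL : Odd (ℓ + 1) ∧ 1 < ℓ + 1} {b₀ b₁ : ℝ}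
variable (i : KIdx d ℓ hd hL b₀ b₁)

/-- **THE LEVEL WINDOW**: `q_ι(f) ≠ 0 ⟹ lvl ι = lev f ∨ lvl ι = lev f + 1` — `f₋` lies in an end block of `ι`, whose level is `lvl ι − 1` or `lvl ι`
([4] (2.2)–(2.4): `lev_ends_bounds`). [cite: Balaban1984PropagatorsII, (2.2)–(2.4) p.224; Balaban1984PropagatorsI, (1.18) p.20] -/
theorem lvl_eq_or_eq_succ_of_qK_ne_zero {ι : IBondY i} {f : FBondY i} (h : qK i ι f ≠ 0) :
    lvl i.hN i.D i.hk ι = levV1 i f.src ∨ lvl i.hN i.D i.hk ι = levV1 i f.src + 1 := by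
  rw [qK_eq_qwt] at h
  have hb := lev_ends_bounds i.hN i.D i.hk (one_le_k i) (two_le_RMh i) ι (ends_of_qwt_ne_zero i h)
  have h1 : 1 ≤ lvl i.hN i.D i.hk ι := one_le_lvl i.hN i.D i.hk (one_le_k i) ι
  change lvl i.hN i.D i.hk ι - 1 ≤ levV1 i f.src ∧ levV1 i f.src ≤ lvl i.hN i.D i.hk ι at hb
  omega

/-- the band from above: `w(ι) ≤ b₁·vol(ι)·c_f²·(L^{lvl ι})⁻²`. [cite: Balaban1984PropagatorsII, (2.16) p.225, (2.20) p.226] -/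
theorem w_le_band (ι : IBondY i) :
    i.w ι ≤ b₁ * volY i ι * (i.cf ^ 2 * ((((ℓ : ℝ) + 1) ^ lvl i.hN i.D i.hk ι)⁻¹) ^ 2) := by
  have hb := (i.hwb ι).2
  have hcf : i.cf ≠ 0 := i.hcf
  have hLj : (0 : ℝ) < (((ℓ + 1 : ℕ) : ℝ)) ^ (ι.1.1 : ℕ) := by positivity
  have hden : (0 : ℝ) < (i.cf / (((ℓ + 1 : ℕ) : ℝ)) ^ (ι.1.1 : ℕ)) ^ 2 := by positivity
  rw [div_le_iff₀ hden] at hb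
  have hv : ((((ℓ + 1 : ℕ) : ℝ)) ^ (ι.1.1 : ℕ)) ^ (d + 1) = volY i ι := by
    unfold volY; rw [← pow_mul, ← pow_mul, mul_comm]
  have hq : (i.cf / (((ℓ + 1 : ℕ) : ℝ)) ^ (ι.1.1 : ℕ)) ^ 2 = i.cf ^ 2 * ((((ℓ : ℝ) + 1) ^ lvl i.hN i.D i.hk ι)⁻¹) ^ 2 := by
    unfold lvl; push_cast; rw [div_eq_mul_inv, mul_pow]
  rw [hv, hq] at hb
  exact hb

/-- the level-`J` part of the column weight: `Σ_{lvl ι = J} w(ι)q_ι(f) ≤ b₁·c_f²·(L^J)⁻²` (`b₁ ≥ 0`): band × (column sums `≤ vol_J⁻¹`).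
[cite: Balaban1984PropagatorsII, (2.20) p.226; Balaban1984PropagatorsI, (1.18) p.20] -/
theorem sum_filter_w_mul_qK_le (hb₁ : 0 ≤ b₁) (J : ℕ) (f : FBondY i) :
    ∑ ι ∈ Finset.univ.filter (fun ι : IBondY i => lvl i.hN i.D i.hk ι = J), i.w ι * qK i ι f
      ≤ b₁ * (i.cf ^ 2 * ((((ℓ : ℝ) + 1) ^ J)⁻¹) ^ 2) := by
  have hvolJ : (0 : ℝ) < ((((ℓ + 1 : ℕ) : ℝ)) ^ (d + 1)) ^ J := by positivity
  have hterm : ∀ ι ∈ Finset.univ.filter (fun ι : IBondY i => lvl i.hN i.D i.hk ι = J),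
      i.w ι * qK i ι f ≤ (b₁ * ((((ℓ + 1 : ℕ) : ℝ)) ^ (d + 1)) ^ J * (i.cf ^ 2 * ((((ℓ : ℝ) + 1) ^ J)⁻¹) ^ 2)) * qwt i.hN i.D i.hk ι f := by
    intro ι hι
    have hJ : lvl i.hN i.D i.hk ι = J := (Finset.mem_filter.1 hι).2
    rw [qK_eq_qwt]
    refine mul_le_mul_of_nonneg_right ?_ (qwt_nonneg i.hN i.D i.hk ι f)
    have h := w_le_band i ι
    have hv : volY i ι = ((((ℓ + 1 : ℕ) : ℝ)) ^ (d + 1)) ^ J := by unfold volY; rw [← hJ]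
    rw [hv, hJ] at h
    exact h
  refine (Finset.sum_le_sum hterm).trans ?_
  rw [← Finset.mul_sum]
  have hcol : ∑ ι ∈ Finset.univ.filter (fun ι : IBondY i => lvl i.hN i.D i.hk ι = J), qwt i.hN i.D i.hk ι f
      ≤ (((((ℓ + 1 : ℕ) : ℝ)) ^ (d + 1)) ^ J)⁻¹ := sum_qwt_lvl_le i J f
  have hc : 0 ≤ b₁ * ((((ℓ + 1 : ℕ) : ℝ)) ^ (d + 1)) ^ J * (i.cf ^ 2 * ((((ℓ : ℝ) + 1) ^ J)⁻¹) ^ 2) := by positivity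
  calc b₁ * ((((ℓ + 1 : ℕ) : ℝ)) ^ (d + 1)) ^ J * (i.cf ^ 2 * ((((ℓ : ℝ) + 1) ^ J)⁻¹) ^ 2)
        * ∑ ι ∈ Finset.univ.filter (fun ι : IBondY i => lvl i.hN i.D i.hk ι = J), qwt i.hN i.D i.hk ι f
      ≤ b₁ * ((((ℓ + 1 : ℕ) : ℝ)) ^ (d + 1)) ^ J * (i.cf ^ 2 * ((((ℓ : ℝ) + 1) ^ J)⁻¹) ^ 2) * (((((ℓ + 1 : ℕ) : ℝ)) ^ (d + 1)) ^ J)⁻¹ :=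
        mul_le_mul_of_nonneg_left hcol hc
    _ = b₁ * (i.cf ^ 2 * ((((ℓ : ℝ) + 1) ^ J)⁻¹) ^ 2) := by field_simp

open Classical in
/-- ★ **THE COLUMN WEIGHT**: `c(f) = Σ_ι w(ι)q_ι(f) ≤ 2b₁·c_f²(L^{lev f})⁻²` (`b₁ ≥ 0`): only the levels `lev f` and `lev f + 1` contribute (§3's window), each
at most `b₁c_f²L^{−2J} ≤ b₁c_f²L^{−2·lev f}`. [cite: Balaban1985BackgroundPropagators, (3.15) p.393; Balaban1984PropagatorsII, (2.20) p.226] -/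
theorem colWeight_qK_le (hb₁ : 0 ≤ b₁) (f : FBondY i) :
    ∑ ι, i.w ι * qK i ι f ≤ 2 * b₁ * (i.cf ^ 2 * ((((ℓ : ℝ) + 1) ^ levV1 i f.src)⁻¹) ^ 2) := by
  set j := levV1 i f.src with hj
  have hsplit : ∑ ι, i.w ι * qK i ι f
      = ∑ ι ∈ Finset.univ.filter (fun ι : IBondY i => lvl i.hN i.D i.hk ι = j ∨ lvl i.hN i.D i.hk ι = j + 1), i.w ι * qK i ι f := by
    refine (Finset.sum_subset (Finset.filter_subset _ _) fun ι _ hι => ?_).symm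
    have hq : qK i ι f = 0 := by
      by_contra hne
      exact hι (Finset.mem_filter.2 ⟨Finset.mem_univ _, lvl_eq_or_eq_succ_of_qK_ne_zero i hne⟩)
    rw [hq, mul_zero]
  have hunion : Finset.univ.filter (fun ι : IBondY i => lvl i.hN i.D i.hk ι = j ∨ lvl i.hN i.D i.hk ι = j + 1)
      = Finset.univ.filter (fun ι : IBondY i => lvl i.hN i.D i.hk ι = j) ∪ Finset.univ.filter (fun ι : IBondY i => lvl i.hN i.D i.hk ι = j + 1) :=
    Finset.filter_or _ _ _
  have hdisj : Disjoint (Finset.univ.filter (fun ι : IBondY i => lvl i.hN i.D i.hk ι = j))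
      (Finset.univ.filter (fun ι : IBondY i => lvl i.hN i.D i.hk ι = j + 1)) := by
    rw [Finset.disjoint_filter]
    intro ι _ h1 h2
    omega
  rw [hsplit, hunion, Finset.sum_union hdisj]
  have h1 := sum_filter_w_mul_qK_le i hb₁ j f
  have h2 := sum_filter_w_mul_qK_le i hb₁ (j + 1) f
  have hL1 : (1 : ℝ) ≤ (ℓ : ℝ) + 1 := by have : (0 : ℝ) ≤ ℓ := Nat.cast_nonneg _; linarith
  have hmono : (i.cf ^ 2 * ((((ℓ : ℝ) + 1) ^ (j + 1))⁻¹) ^ 2) ≤ (i.cf ^ 2 * ((((ℓ : ℝ) + 1) ^ j)⁻¹) ^ 2) := by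
    refine mul_le_mul_of_nonneg_left ?_ (sq_nonneg _)
    have hpj : (0 : ℝ) < ((ℓ : ℝ) + 1) ^ j := pow_pos (lt_of_lt_of_le one_pos hL1) _
    have hle : ((ℓ : ℝ) + 1) ^ j ≤ ((ℓ : ℝ) + 1) ^ (j + 1) := pow_le_pow_right₀ hL1 (Nat.le_succ j)
    have hinv : (((ℓ : ℝ) + 1) ^ (j + 1))⁻¹ ≤ (((ℓ : ℝ) + 1) ^ j)⁻¹ := inv_anti₀ hpj hle
    exact pow_le_pow_left₀ (inv_nonneg.2 (hpj.le.trans hle)) hinv 2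
  have h2' : ∑ ι ∈ Finset.univ.filter (fun ι : IBondY i => lvl i.hN i.D i.hk ι = j + 1), i.w ι * qK i ι f
      ≤ b₁ * (i.cf ^ 2 * ((((ℓ : ℝ) + 1) ^ j)⁻¹) ^ 2) := h2.trans (mul_le_mul_of_nonneg_left hmono hb₁)
  linarith

end Column

/-! ## §4 ★★ (3.15) in the scale-weighted ℓ² norms -/

section Size

open scoped Matrix.Norms.L2Operator

/-- exchanging a weighted double sum (bookkeeping). [cite: Balaban1985BackgroundPropagators, (3.15) p.393, bookkeeping] -/
theorem sum_mul_sum_mul_comm {I F : Type} [Fintype I] [Fintype F] (w : I → ℝ) (q : I → F → ℝ) (h : F → ℝ) :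
    ∑ ι, w ι * ∑ f, q ι f * h f = ∑ f, (∑ ι, w ι * q ι f) * h f := by
  simp_rw [Finset.mul_sum, Finset.sum_mul, mul_assoc]
  exact Finset.sum_comm

variable {d ℓ : ℕ} {hd : 1 ≤ d + 1} {hL : Odd (ℓ + 1) ∧ 1 < ℓ + 1} {b₀ b₁ : ℝ} {N : ℕ}
variable (i : KIdx d ℓ hd hL b₀ b₁) {G : Subgroup (Matrix (Fin N) (Fin N) ℂ)ˣ}

/-- ★★ **(3.15) IN THE SCALE-WEIGHTED ℓ² NORMS**: for a `G`-valued contour table (`G ≤ U(N)`) and `b₁ ≥ 0`,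
`‖Q(U)A‖²_w = trIP w (QA) (QA) ≤ 2b₁ · Σ_b c_f²(L^{lev b})⁻²·HS(A(b))`. [cite: Balaban1985BackgroundPropagators, (3.15) p.393, (3.26) p.395; Balaban1984PropagatorsII, (2.20) p.226] -/
theorem trIP_w_QY_le (hG : G ≤ B7Prop2Explicit.unitaryUnits (Matrix (Fin N) (Fin N) ℂ)) (hb₁ : 0 ≤ b₁) (parB : BondParY (Matrix (Fin N) (Fin N) ℂ) i)
    (U : CfgY (Matrix (Fin N) (Fin N) ℂ) i) (hpar : ∀ s s', parB U s s' ∈ G) (A : FBondY i → Matrix (Fin N) (Fin N) ℂ) :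
    trIP i.w (QY i parB U A) (QY i parB U A)
      ≤ 2 * b₁ * ∑ b, (i.cf ^ 2 * ((((ℓ : ℝ) + 1) ^ levV1 i b.src)⁻¹) ^ 2) * ∑ a, ∑ c, ‖A b a c‖ ^ 2 := by
  rw [trIP_self_eq_sum]
  calc ∑ ι, i.w ι * ∑ a, ∑ c, ‖QY i parB U A ι a c‖ ^ 2
      ≤ ∑ ι, i.w ι * ∑ f, qK i ι f * ∑ a, ∑ c, ‖A f a c‖ ^ 2 :=
        Finset.sum_le_sum fun ι _ => mul_le_mul_of_nonneg_left (hs_QY_apply_le i hG parB U hpar A ι) (i.hw ι).le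
    _ = ∑ f, (∑ ι, i.w ι * qK i ι f) * ∑ a, ∑ c, ‖A f a c‖ ^ 2 :=
        sum_mul_sum_mul_comm i.w (qK i) (fun f => ∑ a, ∑ c, ‖A f a c‖ ^ 2)
    _ ≤ ∑ f, (2 * b₁ * (i.cf ^ 2 * ((((ℓ : ℝ) + 1) ^ levV1 i f.src)⁻¹) ^ 2)) * ∑ a, ∑ c, ‖A f a c‖ ^ 2 :=
        Finset.sum_le_sum fun f _ => mul_le_mul_of_nonneg_right (colWeight_qK_le i hb₁ f) (hs_nonneg (A f))
    _ = 2 * b₁ * ∑ b, (i.cf ^ 2 * ((((ℓ : ℝ) + 1) ^ levV1 i b.src)⁻¹) ^ 2) * ∑ a, ∑ c, ‖A b a c‖ ^ 2 := by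
        rw [Finset.mul_sum]
        refine Finset.sum_congr rfl fun f _ => ?_
        ring

/-- ★★ **THE SAME AT def-Y's TAXICAB TABLE `parBY`** for a `G`-valued configuration, `G ≤ U(N)`. [cite: Balaban1985BackgroundPropagators, (3.15) p.393, (3.35) p.396] -/
theorem trIP_w_QY_parBY_le (hG : G ≤ B7Prop2Explicit.unitaryUnits (Matrix (Fin N) (Fin N) ℂ)) (hb₁ : 0 ≤ b₁)
    {U : CfgY (Matrix (Fin N) (Fin N) ℂ) i} (hU : ∀ μ x, U μ x ∈ G) (A : FBondY i → Matrix (Fin N) (Fin N) ℂ) :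
    trIP i.w (QY i (parBY i) U A) (QY i (parBY i) U A)
      ≤ 2 * b₁ * ∑ b, (i.cf ^ 2 * ((((ℓ : ℝ) + 1) ^ levV1 i b.src)⁻¹) ^ 2) * ∑ a, ∑ c, ‖A b a c‖ ^ 2 :=
  trIP_w_QY_le i hG hb₁ (parBY i) U (fun s s' => parBY_mem i hU s s') A

open B7Prop2SpecialUnitary in
/-- ★★ **THE `hQYSize` BINDER OF `posDefTr_deltaAQY_of_formGap` AT A MEMBER, DISCHARGED WITH `K′ = √(2b₁)`**: for every member `x` of the k-level family and
every `SU(N)`-valued `U`, `‖Q(U)A‖²_w ≤ (√(2θ.b₁))²·Σ_b c_f²(L^{lev b})⁻²·HS(A(b))` (`θ.b₁ ≥ 0` by `θ.hb`).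
[cite: Balaban1985BackgroundPropagators, (3.15) p.393, (3.26) p.395; Balaban1984PropagatorsII, (2.16) p.225] -/
theorem trIP_w_QY_parBY_le_member (θ : Stage3Params) (Mstar : ℕ) (x : MemberY θ.d₆ θ.ℓ₆ θ.hd' θ.hL' θ.b₀ θ.b₁ Mstar)
    {U : CfgY (Matrix (Fin N) (Fin N) ℂ) x.toKIdx} (hU : ∀ μ z, U μ z ∈ specialUnitaryUnits (Fin N))
    (A : FBondY x.toKIdx → Matrix (Fin N) (Fin N) ℂ) :
    trIP x.toKIdx.w (QY x.toKIdx (parBY x.toKIdx) U A) (QY x.toKIdx (parBY x.toKIdx) U A)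
      ≤ Real.sqrt (2 * θ.b₁) ^ 2 *
          ∑ b, (x.toKIdx.cf ^ 2 * ((((θ.ℓ₆ : ℝ) + 1) ^ levV1 x.toKIdx b.src)⁻¹) ^ 2) * ∑ a, ∑ c, ‖A b a c‖ ^ 2 := by
  have hb₁ : 0 ≤ θ.b₁ := le_trans θ.hb.1.le θ.hb.2
  rw [Real.sq_sqrt (by positivity)]
  exact trIP_w_QY_parBY_le x.toKIdx specialUnitaryUnits_le_unitaryUnits hb₁ hU A

end Size

end Literature.MathematicalPhysics.QuantumFieldTheory.Balaban1983to89.B9Eq315QYSizeWeightedL2Y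

end
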